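/-
Copyright (c) 2026. All rights reserved.
Released under Apache 2.0 license as described in the file LICENSE.
Authors: abc-iut cell, prover seat abc-iut-L4-d2 (gen 7).
-/
import Literature.AnabelianGeometry.AbsoluteAnabelian.GaloisTheatersNumberFieldShadowTFPairs
import Literature.AnabelianGeometry.AbsoluteAnabelian.GaloisTheatersNumberFieldShadowRmk511
import Literature.AnabelianGeometry.AbsoluteAnabelian.TPairsCor52Conditional
import HarnessLib

/-!
# [AbsTopIII] Cor 5.2 (iv) PROVED at the `TF`-shadow vocabulary: `TPairIsoCanonical` (F-0192) and `TPairEAHomExtends` (F-0190)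

S. Mochizuki, *Topics in absolute anabelian geometry III* [MochizukiAbsTopIII2015], Cor 5.2 (iv) pp. 119–120 (the functor
`EA⊚ → Th⊚_T`, `Π ↦ M⊚_T(Π)`, is an equivalence onto `An⊚[Th⊚_T]`: essential surjectivity = every global `T`-pair is isomorphic
over `𝟙_Π` to `M⊚_T(Π)`; fullness = morphisms of `EA⊚` extend), Def 5.1 (v) p. 117, Def 4.1 (i) p. 101, Cor 5.2 (i) p. 119.

PROOF-ONLY companion (no `def` / `instance` / `structure`) of `GaloisTheatersNumberFieldShadowTFPairs.lean` (abc-iut-L4-d2 g7),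
the `TF`-analogue of `GaloisTheatersNumberFieldShadowTPairsCor52iv.lean` (g6, `TM`-shadow):

* `isContGlob_descends_fieldShadow`, `isMLFGaloisPair_descends_fieldShadow`, `isAutHolPair_descends_fieldShadow` — the three
  DEFINITIONAL descent laws of `TPairVocabulary.tPairIsoCanonical_of_descent` hold at the `TF`-shadow (the third now with
  content: injectivity of a Kummer embedding descends along transport `i_A ∘ κ ∘ ψ⁻¹`);
* `tPairIsoCanonical_fieldShadow : TPairIsoCanonical (fieldShadowVocabulary F) tf_ne_tlg` — **F-0192** PROVED at the `TF`-shadow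
  (with `k_NF(𝟙_Π) = id`, `context_mapKNF_id`);
* `tPairEAHomExtends_fieldShadow : TPairEAHomExtends (fieldShadowVocabulary F) tf_ne_tlg` — **F-0190** PROVED at the `TF`-shadow:
  a morphism `f` of `EA⊚` between admissibles extends to `M⊚_TF(Π₁) → M⊚_TF(Π₂)` with theater part Cor 5.2 (i)
  (`eaHomExtendsToTheaters_context`, g6) and `φ⊚ = φ_v :=` the conjugator `τ_f` acting on `ℚ̄` as a FIELD automorphism; the
  archimedean clause (c) now has CONTENT — the transported Kummer embedding `φ_{v,A} ∘ κ_{ell,v₁} ∘ τ_f⁻¹` EQUALS `κ_{ell,v₂}` by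
  the κ-compatibility of the theater morphism (`kummerTransportTF_conjugator`).

With `…TFPairsCor52iii.lean` (F-0189 / F-0191) this makes ALL FOUR Cor 5.2 (iii)/(iv) rows theorems at
`(R, W) := (context F, fieldShadowVocabulary F)`.  HONEST LABEL: shadow (`Δ = 1`), algebraic parts, group-theoretic MLF-pair
predicate, stub cyclotomes; NOT the genuine `(R, W)` (E-L4-13).  Nothing here bears on [IUTchIII] Cor. 3.12; typed ≠ proved.
-/

noncomputable section

open scoped Pointwise Topology
open CategoryTheory NumberField Field

namespace Literature.AnabelianGeometry.AbsoluteAnabelian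

namespace NumberFieldShadow

variable (F : Type) [Field F] [NumberField F]

/-! ### The descent laws at the `TF`-shadow vocabulary -/

/-- Open stabilisers DESCEND along an equivariant isomorphism of `T⊚`-objects (the continuity predicate of the `TF`-shadow
vocabulary). [cite: MochizukiAbsTopIII2015, Def 5.1 (v) p.117] -/
theorem isContGlob_descends_fieldShadow {G : ProfiniteGrp.{0}} {M N : (fieldShadowVocabulary F).GlobObj}
    (a : G →* Aut M) (b : G →* Aut N) (ψ : M ≅ N) (h : ∀ g, (a g).hom ≫ ψ.hom = ψ.hom ≫ (b g).hom)
    (hb : (fieldShadowVocabulary F).IsContGlob b) : (fieldShadowVocabulary F).IsContGlob a := by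
  intro m
  obtain ⟨U, hU⟩ := hb (ψ.hom.hom m)
  refine ⟨U, fun u hu => ?_⟩
  have hinj : Function.Injective ψ.hom.hom :=
    (ψ.commRingCatIsoToRingEquiv : (show CommRingCat.{0} from M) ≃+* (show CommRingCat.{0} from N)).injective
  apply hinj
  have e := congrArg (fun φ : M ⟶ N => φ.hom m) (h u)
  change ψ.hom.hom ((a u).hom.hom m) = (b u).hom.hom (ψ.hom.hom m) at e
  exact e.trans (hU u hu)

/-- "The group is of MLF-Galois type" DESCENDS along isomorphisms of topological groups (the MLF-Galois-pair predicate of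
the `TF`-shadow vocabulary). [cite: MochizukiAbsTopIII2015, Def 5.1 (v) p.117] -/
theorem isMLFGaloisPair_descends_fieldShadow {D D' : ProfiniteGrp.{0}} {M N : (fieldShadowVocabulary F).LocObj}
    (a : D →* Aut M) (b : D' →* Aut N) (e : D ≃ₜ* D') (ψ : M ≅ N)
    (_h : ∀ g, (a g).hom ≫ ψ.hom = ψ.hom ≫ (b (e g)).hom)
    (hb : (fieldShadowVocabulary F).IsMLFGaloisPair b) : (fieldShadowVocabulary F).IsMLFGaloisPair a :=
  IsMLFGaloisType.of_continuousMulEquiv hb e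

/-- Injectivity of a Kummer embedding DESCENDS along transport `i_A ∘ κ ∘ ψ⁻¹` (the Aut-holomorphic-pair predicate of the
`TF`-shadow vocabulary; Def 4.1 (i): Kummer structures are injections). [cite: MochizukiAbsTopIII2015, Def 4.1 (i) p.101] -/
theorem isAutHolPair_descends_fieldShadow {X Y : AutHolOrbispace.{0}} {M N : (fieldShadowVocabulary F).LocObj}
    (i : AutHolOrbispace.Iso X Y) (ψ : M ≅ N) (k : (fieldShadowVocabulary F).KummerStr X M)
    (hk : (fieldShadowVocabulary F).IsAutHolPair ((fieldShadowVocabulary F).kummerTransport i ψ k)) :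
    (fieldShadowVocabulary F).IsAutHolPair k := by
  change Function.Injective (kummerTransportTF i ψ (show (show CommRingCat.{0} from M) →+* X.fieldA from k)) at hk
  change Function.Injective (show (show CommRingCat.{0} from M) →+* X.fieldA from k)
  intro x y hxy
  have hψ : Function.Injective ψ.hom.hom :=
    (ψ.commRingCatIsoToRingEquiv : (show CommRingCat.{0} from M) ≃+* (show CommRingCat.{0} from N)).injective
  apply hψ
  apply hk
  rw [kummerTransportTF_apply, kummerTransportTF_apply]
  have ex : ψ.inv.hom (ψ.hom.hom x) = x := congrArg (fun φ : M ⟶ M => φ.hom x) ψ.hom_inv_id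
  have ey : ψ.inv.hom (ψ.hom.hom y) = y := congrArg (fun φ : M ⟶ M => φ.hom y) ψ.hom_inv_id
  rw [ex, ey]
  exact congrArg i.fieldIso hxy

/-! ### F-0192: every global `TF`-pair is isomorphic to the canonical one -/

/-- **Cor 5.2 (iv), essential surjectivity (F-0192), PROVED at the `TF`-shadow vocabulary**: every global `TF`-pair over the
shadow is isomorphic over `𝟙_Π` to the canonical pair `M⊚_TF(Π)` (via `tPairIsoCanonical_of_descent`: `k_NF(𝟙_Π) = id` and the
three descent laws). [cite: MochizukiAbsTopIII2015, Cor 5.2 (iv) p.120] -/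
theorem tPairIsoCanonical_fieldShadow : TPairIsoCanonical (fieldShadowVocabulary F) tf_ne_tlg :=
  (fieldShadowVocabulary F).tPairIsoCanonical_of_descent tf_ne_tlg (context_mapKNF_id F)
    (fun a b ψ h hb => isContGlob_descends_fieldShadow F a b ψ h hb)
    (fun a b e ψ h hb => isMLFGaloisPair_descends_fieldShadow F a b e ψ h hb)
    (fun i ψ k hk => isAutHolPair_descends_fieldShadow F i ψ k hk)

/-! ### F-0190: morphisms of `EA⊚` extend to the canonical global `TF`-pairs -/

/-- The action of the conjugator `τ_f` on `ℚ̄` intertwines the chart actions of `Π₁` and `Π₂` (the chart-transition law on the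
field). [cite: MochizukiAbsTopIII2015, Def 5.1 (iii) p.115] -/
theorem conjugator_smul_field {E₁ E₂ : FundamentalExtension.{0}} (f : E₁ ⟶ E₂) (hf : IsEAHom f) (g : E₁.arith)
    (x : AlgebraicClosure ℚ) :
    conjugator f hf • (ratChart E₁ g • x) = ratChart E₂ (f.arith g) • (conjugator f hf • x) := by
  rw [ratChart_comp_eq_conj f hf g, mul_smul, mul_smul, inv_smul_smul]

/-- **The archimedean Kummer clause (c) with content**: along an isomorphism `φ_v : X(Π₁, v₁) ≅ X(Π₂, v₂)` of the stub orbispaces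
that is κ-compatible through `k_NF(f) = τ_f` (as supplied by Cor 5.2 (i) at the shadow), the Kummer embedding `κ_{ell,v₁}`
transported along `(φ_v, τ_f)` IS `κ_{ell,v₂}`. [cite: MochizukiAbsTopIII2015, Def 5.1 (v) p.117] -/
theorem kummerTransportTF_conjugator {E₁ E₂ : FundamentalExtension.{0}} (f : E₁ ⟶ E₂) (hf : IsEAHom f)
    (v : (contextProVal E₁).arc) (w : (contextProVal E₂).arc)
    (φv : AutHolOrbispace.Iso (contextArchSpace E₁ v) (contextArchSpace E₂ w))
    (hκ : ∀ x : AlgebraicClosure ℚ, contextKappa E₂ w (contextMapKNF f hf x) = φv.fieldIso (contextKappa E₁ v x)) :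
    kummerTransportTF φv (fieldAutHom (conjugator f hf)) (contextKappa E₁ v) = contextKappa E₂ w := by
  refine RingHom.ext fun n => ?_
  rw [kummerTransportTF_apply, fieldAutHom_inv_apply, ← hκ]
  change contextKappa E₂ w (conjugator f hf • ((conjugator f hf)⁻¹ • n)) = contextKappa E₂ w n
  rw [smul_inv_smul]

/-- **Cor 5.2 (iv), full faithfulness (F-0190), PROVED at the `TF`-shadow vocabulary**: every morphism of `EA⊚` between
admissible `Π₁, Π₂` extends to a morphism of the canonical global `TF`-pairs — theater part: Cor 5.2 (i) at the shadow
(`eaHomExtendsToTheaters_context`); `φ⊚ = φ_v :=` the conjugator `τ_f` acting on `ℚ̄` by a field automorphism (equivariant by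
the chart-transition law); archimedean clause (c): the transported Kummer embedding is `κ_{ell,v₂}` (`kummerTransportTF_conjugator`).
[cite: MochizukiAbsTopIII2015, Cor 5.2 (iv) p.120] -/
theorem tPairEAHomExtends_fieldShadow : TPairEAHomExtends (fieldShadowVocabulary F) tf_ne_tlg := by
  intro E₁ E₂ h₁ h₂ hc₁ hM₁ hA₁ hc₂ hM₂ hA₂ f hf
  obtain ⟨φV, hφV⟩ := eaHomExtendsToTheaters_context F E₁ E₂ h₁ h₂ f hf
  subst hφV
  let τ : absoluteGaloisGroup ℚ := conjugator φV.φgrp hf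
  let φM : (CommRingCat.of (AlgebraicClosure ℚ) : CommRingCat.{0}) ≅ CommRingCat.of (AlgebraicClosure ℚ) :=
    fieldAutHom τ
  have hφM : ∀ x : AlgebraicClosure ℚ, φM.hom.hom x = τ • x := fun _ => rfl
  have non_mem : ∀ v : ((context F).theater E₁ h₁).V.non, φV.φV v ∈ ((context F).theater E₂ h₂).V.non := by
    intro v
    have h : φV.φV v ∈ φV.φV '' ((context F).theater E₁ h₁).V.non := ⟨v, v.2, rfl⟩
    rw [φV.image_non] at h
    exact h
  have arc_mem : ∀ v : ((context F).theater E₁ h₁).V.arc, φV.φV v ∈ ((context F).theater E₂ h₂).V.arc := by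
    intro v
    have h : φV.φV v ∈ φV.φV '' ((context F).theater E₁ h₁).V.arc := ⟨v, v.2, rfl⟩
    rw [φV.image_arc] at h
    exact h
  refine ⟨{ φV := φV
            φM := φM
            φM_equivariant := fun g => ?_
            non_mem := non_mem
            arc_mem := arc_mem
            φnon := fun _ => φM
            φnon_equivariant := fun v g hg hg' => ?_
            φarc := fun _ => φM
            φarc_kummer := fun v => ?_
            ρnon_comm := fun v => ?_
            ρarc_comm := fun v => ?_ }, rfl⟩
  · change (fieldGlobAct E₁ g).hom ≫ φM.hom = φM.hom ≫ (fieldGlobAct E₂ (φV.φgrp.arith g)).hom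
    ext x
    change φM.hom.hom (ratChart E₁ g • x) = ratChart E₂ (φV.φgrp.arith g) • φM.hom.hom x
    rw [hφM, hφM]
    exact conjugator_smul_field φV.φgrp hf g x
  · change (fieldGlobAct E₁ g).hom ≫ φM.hom = φM.hom ≫ (fieldGlobAct E₂ (φV.φgrp.arith g)).hom
    ext x
    change φM.hom.hom (ratChart E₁ g • x) = ratChart E₂ (φV.φgrp.arith g) • φM.hom.hom x
    rw [hφM, hφM]
    exact conjugator_smul_field φV.φgrp hf g x
  · obtain ⟨φv, -, hinner, hκ⟩ := φV.arch_compat v (arc_mem v)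
    exact ⟨φv, hinner, hκ, kummerTransportTF_conjugator φV.φgrp hf v ⟨φV.φV v.1, arc_mem v⟩ φv hκ⟩
  · change 𝟙 _ ≫ (𝟭 CommRingCat.{0}).map φM.hom = φM.hom ≫ 𝟙 _
    rw [Functor.id_map, Category.id_comp, Category.comp_id]
  · change 𝟙 _ ≫ (𝟭 CommRingCat.{0}).map φM.hom = φM.hom ≫ 𝟙 _
    rw [Functor.id_map, Category.id_comp, Category.comp_id]

end NumberFieldShadow

end Literature.AnabelianGeometry.AbsoluteAnabelian

end
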